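import Mathlib
import Literature.AlgebraicGeometry.Resolution.ResolutionOfSingularities
import Literature.AlgebraicGeometry.Resolution.QuasiExcellentSchemes

/-!
# Sketch — first lemmas of the crux idea cards for `descent_perfect_to_all` (stmt-0549)

Card `arc-special-fibre-transversality`: `PropagationFromClosedFibre`, `KunzCriterion`,
`RegularDescendsFlatLocal`.
Card `constant-foliation-descent`: `InvariantsRegularOfNonsingularDerivation`.
Nothing here is proved; these are the first checkable statements of each line (they must only
elaborate).
-/

open AlgebraicGeometry CategoryTheory

namespace Summit.ResolutionOfSingularities.ResolutionOfSingularities.Cruxes.descent_perfect_to_all.Sketch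

/-- ARC CARD, first lemma (propagation from the closed fibre). If `f : Y ⟶ Spec R` is proper,
`R` a local ring, the regular locus of `Y` is open (true when `Y` is quasi-excellent, EGA IV₂
7.8.6 / Stacks 07P7), and `Y` is regular at every point of the closed fibre, then `Y` is regular:
every point specialises into the closed fibre (closed map) and an open set is stable under
generisation. -/
def PropagationFromClosedFibre : Prop :=
  ∀ (R : Type) [CommRing R] [IsLocalRing R] (Y : Scheme.{0}) (f : Y ⟶ Spec (.of R)),
    IsProper f →
    IsOpen (Literature.AlgebraicGeometry.Resolution.Scheme.regularLocus Y) →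
    (∀ y : Y, f.base y = IsLocalRing.closedPoint R → IsRegularLocalRing (Y.presheaf.stalk y)) →
    Literature.AlgebraicGeometry.Resolution.Scheme.IsRegular Y

/-- ARC CARD, engine (Kunz 1969, Thm. 2.1: a Noetherian local ring of characteristic `p` is
regular iff its Frobenius endomorphism is flat) — the direction used: flat Frobenius ⇒ regular.
With it, a Noetherian local ring that is a filtered colimit of regular rings of characteristic
`p` along flat transition maps is regular (Frobenius of the colimit is the colimit of flat maps). -/
def KunzCriterion (p : ℕ) [Fact p.Prime] : Prop :=
  ∀ (R : Type) [CommRing R] [IsNoetherianRing R] [IsLocalRing R] [CharP R p],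
    (frobenius R p).Flat → IsRegularLocalRing R

/-- ARC CARD, descent half (Matsumura, CRT Thm. 23.7 (i)): regularity descends along flat
local homomorphisms. Used as: `Y_L ⊗_L Ω` regular for SOME overfield `Ω ⊇ K` ⇒ `Y_L ⊗_L K`
regular. -/
def RegularDescendsFlatLocal : Prop :=
  ∀ (R S : Type) [CommRing R] [CommRing S] [IsLocalRing R] [IsNoetherianRing R] [IsLocalRing S]
    [Algebra R S], IsLocalHom (algebraMap R S) → Module.Flat R S → IsRegularLocalRing S →
    IsRegularLocalRing R

/-- FOLIATION CARD, first lemma (Aramova–Avramov 1986 / Zerla; rank-one case of the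
Jacobson–Yuan criterion): if `R` is a regular local ring of characteristic `p`, `D` a derivation
of `R`, `S = ker D` and `R` is module-finite over `S`, and `D` is NONSINGULAR (`D x` is a unit
for some `x`), then the ring of constants `S` is again a regular local ring. (Conversely, if
`D(𝔪) ⊆ 𝔪` then `S` is not regular unless `D = 0` on a neighbourhood — not stated.) -/
def InvariantsRegularOfNonsingularDerivation (p : ℕ) [Fact p.Prime] : Prop :=
  ∀ (R : Type) [CommRing R] [IsRegularLocalRing R] [CharP R p] (D : Derivation ℤ R R)
    (S : Subring R), (∀ x : R, x ∈ S ↔ D x = 0) → Module.Finite S R →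
    (∃ x : R, IsUnit (D x)) → IsRegularLocalRing S

end Summit.ResolutionOfSingularities.ResolutionOfSingularities.Cruxes.descent_perfect_to_all.Sketch
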